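import Summits.AtomisticToContinuum.HydrodynamicLimit.Theorems.AntiMazurCoboundariesKineticFluxLdDecayClampedJumpPressure
import Literature.Analysis.FluidPDE.HardSphereClampedTimesMeasurable
import HarnessLib

/-!
# Stub S6a `stub_causalFiltration` of the crux line `dynkin-azuma-collision-innovations`
# (crux `KineticFluxLdDecay`, stmt-AtomisticToContinuum-10967)

Helper file (`--supports stmt-AtomisticToContinuum-10967`) closing the registered stub
`stub_causalFiltration` (S6a) of the skeleton
`Cruxes/KineticFluxLdDecay/Lines/dynkin-azuma-collision-innovations.lean`, over the objects module
`AntiMazurCoboundariesKineticFluxLdDecayObjects` (`Flow`, `Phase`, `window`, `sv`, `stopTime`,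
`counted`, `relTimes`, `relCount`, `relTime`, `bin`, `binVal`, `binVec`, `preVelOf`, `particleMarkAt`,
`markAt`, `payloadAt`, `payloadY`, `procX`, `record`, `causalSigma`).

**Statement.** For continuous `φ'`, `ψ₀` and every torus hard-sphere flow `Φ` there is a filtration
`ℱ` of the Borel σ-algebra `m0` of phase space with `ℱ n ≤ causalSigma … n` (the σ-algebra of the
coarse causal record before the `n`-th relevant collision) to which the binned payload process `X̃`
is strongly adapted.  We take `ℱ n = causalSigma … n` itself.

**Proof.** (i) `causalSigma … n ≤ m0` (`causalSigma_le`): the record `z ↦ record … n z` is Borel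
measurable into the countable product of discrete mark spaces (`measurable_record`).  Off the good
set it is constant; on the good set its `m`-th entry is the mark of the `m`-th relevant collision,
guarded by the event `{m < relCount}`.  The relevant collision times are the clamped collision times
of the window (`relTimes_eq`, S3), a finite measurably indexed family of the per-particle collision
times `Φ.nthCollisionTimeOf i k z`, so their enumeration `relTime … z m`, the events
`{m < relCount}` and the configuration `Φ_{relTime z m} z` are measurable on the good set
(`Literature.Analysis.FluidPDE.HardSphereClampedTimesMeasurable`); the marks are cells, binned
(floors of) continuous functions of positions / velocities / pre-collisional velocities
(`measurable_preVel_partner`), the participation flag (`measurableSet_participates`) and the counted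
flag (`{relTime ≤ stopTime}`, the clamp being measurable) read at that configuration.
(ii) `X̃ₙ = Σ_{m<n} Ỹₘ` is `causalSigma … n`-measurable (`measurable_procX_causalSigma`): for `m < n`
the payload `Ỹₘ` is a function of the `m`-th entry of the record (`payloadY_eq_of_record_eq`: the
binned values `binVal r x = r ⌊x/r⌋` and the counted flag entering `payloadAt` are stored in the
particle marks), a countably-valued coordinate, and every function of a countably-valued measurable
coordinate is measurable (`measurable_comap_of_factorsThrough`).  (iii) Monotonicity is
`causalSigma_le_succ` (S0); real-valued measurable maps are strongly measurable.

References: C. Kipnis, C. Landim, *Scaling Limits of Interacting Particle Systems* (1999), App. 1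
§5–6 (Dynkin martingales along natural filtrations of jump marks); I. Gallagher, L. Saint-Raymond,
B. Texier, *From Newton to Boltzmann* (2013), §4.1 (collision times and marks of the hard-sphere flow).
-/

noncomputable section

open MeasureTheory ProbabilityTheory Set Filter
open scoped ENNReal BigOperators
open Literature.Analysis.FluidPDE Literature.MathematicalPhysics.KineticTheory

namespace Summit.AtomisticToContinuum.HydrodynamicLimit.Theorems.DynkinAzuma

variable {σ : ℝ} {N : ℕ}

/-! ## A function of a countably-valued measurable coordinate is measurable -/

/-- **Doob–Dynkin for a discrete coordinate.**  If `f` factors through `π ∘ ρ` with `π` a measurable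
map into a countable space with measurable singletons, then `f` is measurable with respect to the
σ-algebra generated by `ρ` (every function out of such a space is measurable). [folklore] -/
theorem measurable_comap_of_factorsThrough {α β γ δ : Type*} [MeasurableSpace β] [MeasurableSpace γ]
    [MeasurableSpace δ] [Countable δ] [MeasurableSingletonClass δ] [Nonempty γ] (ρ : α → β)
    {π : β → δ} (hπ : Measurable π) {f : α → γ}
    (hf : ∀ a a', π (ρ a) = π (ρ a') → f a = f a') :
    Measurable[MeasurableSpace.comap ρ inferInstance] f := by
  obtain ⟨g, hg⟩ := (Function.factorsThrough_iff (f := fun a => π (ρ a)) f).1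
    (fun a a' h => hf a a' h)
  rw [hg]
  exact ((measurable_of_countable g).comp hπ).comp (comap_measurable ρ)

/-! ## Measurability on the good set: relevant times, their number, the clamp, the marks -/

/-- **The time of the `m`-th relevant collision is measurable on the good set** (the relevant times
are the clamped collision times, `relTimes_eq`, enumerated measurably,
`HardSphereFlow.measurable_nthTimeAfter_clampedTimes_comp_subtype_torus`). [folklore] -/
theorem measurable_relTime_comp_subtype (Φ : Flow σ N) (K : ℕ) (h : ℝ) (m : ℕ) :
    Measurable fun z : Φ.good => relTime Φ K h (z : Phase N) m := by
  convert Φ.measurable_nthTimeAfter_clampedTimes_comp_subtype_torus h K m using 2 with z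
  rw [relTime, relTimes_eq Φ K h z.2]

/-- **"At least `m + 1` relevant collisions" is a measurable event on the good set.** [folklore] -/
theorem measurableSet_lt_relCount (Φ : Flow σ N) (K : ℕ) (h : ℝ) (m : ℕ) :
    MeasurableSet {z : Φ.good | m < relCount Φ K h (z : Phase N)} := by
  convert Φ.measurableSet_lt_ncard_clampedTimes_torus h K m using 3 with z
  rw [relCount, relTimes_eq Φ K h z.2]

/-- **The stopping time (clamp) of a particle is measurable on the good set.** [folklore] -/
theorem measurable_stopTime_comp_subtype (Φ : Flow σ N) (K : ℕ) (h : ℝ) (i : Fin (N + 1)) :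
    Measurable fun z : Φ.good => stopTime Φ K h i (z : Phase N) := by
  convert Φ.measurable_clamp_comp_subtype_torus i h K using 2 with z
  exact stopTime_eq_clamp Φ K h i z.2

/-- **The configuration at the `m`-th relevant collision is measurable on the good set** (joint
measurability of the flow on `good × ℝ`). [folklore] -/
theorem measurable_flow_relTime_comp_subtype (Φ : Flow σ N) (K : ℕ) (h : ℝ) (m : ℕ) :
    Measurable fun z : Φ.good => Φ.flow (relTime Φ K h (z : Phase N) m) (z : Phase N) :=
  Φ.measurable_flow_prod_torus.comp (measurable_id.prodMk (measurable_relTime_comp_subtype Φ K h m))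

/-- **The counted flag of a particle at the `m`-th relevant collision is measurable on the good
set**: the event is "participates at `Φ_{relTime} z`" (a measurable event of the configuration,
`measurableSet_participates`) and "`relTime ≤ stopTime`". [folklore] -/
theorem measurable_counted_relTime_comp_subtype (Φ : Flow σ N) (K : ℕ) (h : ℝ) (m : ℕ)
    (i : Fin (N + 1)) :
    Measurable fun z : Φ.good => counted Φ K h (relTime Φ K h (z : Phase N) m) i (z : Phase N) := by
  refine measurable_to_bool ?_
  have hset : (fun z : Φ.good => counted Φ K h (relTime Φ K h (z : Phase N) m) i (z : Phase N)) ⁻¹'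
        {true} =
      (fun z : Φ.good => Φ.flow (relTime Φ K h (z : Phase N) m) (z : Phase N)) ⁻¹'
          {ζ : Phase N | Participates (Torus.geometry (Fin 3)) (hsDiameter σ N) ζ i} ∩
        {z : Φ.good | relTime Φ K h (z : Phase N) m ≤ stopTime Φ K h i (z : Phase N)} := by
    ext z
    simp only [mem_preimage, mem_singleton_iff, counted, decide_eq_true_eq, mem_inter_iff,
      mem_setOf_eq]
  rw [hset]
  exact ((measurableSet_participates Torus.measurable_geometry_sepVec i).preimage
    (measurable_flow_relTime_comp_subtype Φ K h m)).inter
    (measurableSet_le (measurable_relTime_comp_subtype Φ K h m)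
      (measurable_stopTime_comp_subtype Φ K h i))

/-- Binning a measurable real function gives a measurable integer label. [folklore] -/
theorem measurable_bin_comp {α : Type*} [MeasurableSpace α] {f : α → ℝ} (hf : Measurable f) (r : ℝ) :
    Measurable fun a => bin r (f a) :=
  Int.measurable_floor.comp (hf.div_const r)

/-- Binning a measurable velocity coordinatewise gives a measurable integer vector. [folklore] -/
theorem measurable_binVec_comp {α : Type*} [MeasurableSpace α] {f : α → V3} (hf : Measurable f)
    (r : ℝ) : Measurable fun a => binVec r (f a) :=
  measurable_pi_lambda _ fun k => Int.measurable_floor.comp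
    ((((measurable_pi_apply k).comp (WithLp.measurable_ofLp 2 (Fin 3 → ℝ))).comp hf).div_const r)

/-- The scaled peculiar velocity map is continuous. [folklore] -/
theorem continuous_sv (θ : ℝ) (u₀ : V3) : Continuous (sv θ u₀) := by
  unfold sv
  fun_prop

/-- **The discrete mark of a particle at the `m`-th relevant collision is measurable on the good
set** (cells, binned continuous functions of the measurable configuration `Φ_{relTime} z`, of its
pre-collisional velocities `measurable_preVel_partner`, and the two flags). [folklore] -/
theorem measurable_particleMarkAt_relTime_comp_subtype (θ : ℝ) (u₀ : V3) {φ' : T3 → ℝ}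
    {ψ₀ : V3 → ℝ} (hφ : Continuous φ') (hψ : Continuous ψ₀) (K : ℕ) (h δx δv δφ δ₀ : ℝ)
    (Φ : Flow σ N) (m : ℕ) (i : Fin (N + 1)) :
    Measurable fun z : Φ.good =>
      particleMarkAt θ u₀ φ' ψ₀ K h δx δv δφ δ₀ Φ (relTime Φ K h (z : Phase N) m) (z : Phase N) i := by
  have hF := measurable_flow_relTime_comp_subtype Φ K h m
  have hx : Measurable fun z : Φ.good =>
      (Φ.flow (relTime Φ K h (z : Phase N) m) (z : Phase N) i).1 := ((measurable_pi_apply i).comp hF).fst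
  have hv : Measurable fun z : Φ.good =>
      (Φ.flow (relTime Φ K h (z : Phase N) m) (z : Phase N) i).2 := ((measurable_pi_apply i).comp hF).snd
  have hpre : Measurable fun z : Φ.good =>
      preVelOf (σ := σ) (Φ.flow (relTime Φ K h (z : Phase N) m) (z : Phase N)) i :=
    (measurable_preVel_partner (N := N + 1) Torus.measurable_geometry_sepVec (hsDiameter σ N) 0 i).comp
      hF
  have hsv := (continuous_sv θ u₀).measurable
  have hpart : MeasurableSet {z : Φ.good | Participates (Torus.geometry (Fin 3)) (hsDiameter σ N)
      (Φ.flow (relTime Φ K h (z : Phase N) m) (z : Phase N)) i} :=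
    (measurableSet_participates Torus.measurable_geometry_sepVec i).preimage hF
  simp only [particleMarkAt]
  refine ((Torus.measurable_coarseCell δx).comp hx).prodMk
    ((measurable_binVec_comp (hsv.comp hv) δv).prodMk
    ((measurable_binVec_comp (hsv.comp hpre) δv).prodMk
    ((measurable_bin_comp (hφ.measurable.comp hx) δφ).prodMk
    ((measurable_bin_comp (hψ.measurable.comp (hsv.comp hv)) δ₀).prodMk
    ((measurable_bin_comp (hψ.measurable.comp (hsv.comp hpre)) δ₀).prodMk
    (Measurable.prodMk ?_ (measurable_counted_relTime_comp_subtype Φ K h m i)))))))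
  refine measurable_to_bool ?_
  simpa only [preimage, mem_singleton_iff, decide_eq_true_eq] using hpart

/-- **The mark of the `m`-th relevant collision is measurable on the good set.** [folklore] -/
theorem measurable_markAt_relTime_comp_subtype (θ : ℝ) (u₀ : V3) {φ' : T3 → ℝ} {ψ₀ : V3 → ℝ}
    (hφ : Continuous φ') (hψ : Continuous ψ₀) (K : ℕ) (h δt δx δv δφ δ₀ : ℝ) (Φ : Flow σ N)
    (m : ℕ) :
    Measurable fun z : Φ.good =>
      markAt θ u₀ φ' ψ₀ K h δt δx δv δφ δ₀ Φ (relTime Φ K h (z : Phase N) m) (z : Phase N) := by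
  unfold markAt
  exact (measurable_bin_comp (measurable_relTime_comp_subtype Φ K h m) δt).prodMk
    (measurable_pi_lambda _ fun i =>
      measurable_particleMarkAt_relTime_comp_subtype θ u₀ hφ hψ K h δx δv δφ δ₀ Φ m i)

/-! ## The record is Borel measurable; the causal σ-algebras are sub-σ-algebras -/

/-- **The causal coarse record is Borel measurable** (into the countable product of the discrete
mark spaces): constant off the good set, and on the good set its `m`-th entry is the measurable mark
of the `m`-th relevant collision guarded by the measurable event `{m < relCount}`. [folklore] -/
theorem measurable_record (θ : ℝ) (u₀ : V3) {φ' : T3 → ℝ} {ψ₀ : V3 → ℝ} (hφ : Continuous φ')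
    (hψ : Continuous ψ₀) (K : ℕ) (τ δt δx δv δφ δ₀ : ℝ) (Φ : Flow σ N) (n : ℕ) :
    Measurable (record θ u₀ φ' ψ₀ K τ δt δx δv δφ δ₀ Φ n) := by
  classical
  refine measurable_pi_lambda _ fun m => ?_
  refine measurable_of_restrict_of_restrict_compl Φ.measurableSet_good ?_ ?_
  · have heq : Φ.good.restrict (fun z => record θ u₀ φ' ψ₀ K τ δt δx δv δφ δ₀ Φ n z m) =
        fun z : Φ.good => if m < n ∧ m < relCount Φ K (window τ N) (z : Phase N) then
          (true, markAt θ u₀ φ' ψ₀ K (window τ N) δt δx δv δφ δ₀ Φ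
            (relTime Φ K (window τ N) (z : Phase N) m) (z : Phase N))
        else (false, default) := by
      funext z
      simp only [restrict_apply, record]
      by_cases hc : m < n ∧ m < relCount Φ K (window τ N) (z : Phase N)
      · rw [if_pos ⟨z.2, hc⟩, if_pos hc]
      · rw [if_neg (fun h' => hc h'.2), if_neg hc]
    rw [heq]
    refine Measurable.ite ?_ (measurable_const.prodMk
      (measurable_markAt_relTime_comp_subtype θ u₀ hφ hψ K (window τ N) δt δx δv δφ δ₀ Φ m))
      measurable_const
    exact (MeasurableSet.const _).inter (measurableSet_lt_relCount Φ K (window τ N) m)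
  · have heq : Φ.goodᶜ.restrict (fun z => record θ u₀ φ' ψ₀ K τ δt δx δv δφ δ₀ Φ n z m) =
        fun _ => (false, default) := by
      funext z
      simp only [restrict_apply, record]
      rw [if_neg (fun h' => z.2 h'.1)]
    rw [heq]
    exact measurable_const

/-- **The causal coarse σ-algebras are sub-σ-algebras of the Borel σ-algebra** of phase space.
[folklore] -/
theorem causalSigma_le (θ : ℝ) (u₀ : V3) {φ' : T3 → ℝ} {ψ₀ : V3 → ℝ} (hφ : Continuous φ')
    (hψ : Continuous ψ₀) (K : ℕ) (τ δt δx δv δφ δ₀ : ℝ) (Φ : Flow σ N) (n : ℕ) :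
    causalSigma θ u₀ φ' ψ₀ K τ δt δx δv δφ δ₀ Φ n ≤ (inferInstance : MeasurableSpace (Phase N)) :=
  (measurable_record θ u₀ hφ hψ K τ δt δx δv δφ δ₀ Φ n).comap_le

/-! ## The payload process is adapted to the causal σ-algebras -/

/-- **`Ỹₘ` is a function of the `m`-th entry of the record before collision `n > m`**: the entry
is masked exactly when `Ỹₘ = 0` (off the good set or beyond `relCount`), and otherwise stores the
binned values `⌊φ'/δφ⌋`, `⌊ψ₀(w⁺)/δ₀⌋`, `⌊ψ₀(w⁻)/δ₀⌋` and the counted flag of every particle, of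
which `payloadAt` (`binVal r x = r ⌊x/r⌋`) is a function. [folklore] -/
theorem payloadY_eq_of_record_eq (θ : ℝ) (u₀ : V3) (φ' : T3 → ℝ) (ψ₀ : V3 → ℝ) (c b : ℝ) (K : ℕ)
    (τ δt δx δv δφ δ₀ : ℝ) (Φ : Flow σ N) {m n : ℕ} (hmn : m < n) {z z' : Phase N}
    (h : record θ u₀ φ' ψ₀ K τ δt δx δv δφ δ₀ Φ n z m = record θ u₀ φ' ψ₀ K τ δt δx δv δφ δ₀ Φ n z' m) :
    payloadY θ u₀ φ' ψ₀ c b K τ δφ δ₀ Φ m z = payloadY θ u₀ φ' ψ₀ c b K τ δφ δ₀ Φ m z' := by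
  classical
  unfold record at h
  unfold payloadY
  by_cases hz : z ∈ Φ.good ∧ m < relCount Φ K (window τ N) z <;>
    by_cases hz' : z' ∈ Φ.good ∧ m < relCount Φ K (window τ N) z'
  · rw [if_pos ⟨hz.1, hmn, hz.2⟩, if_pos ⟨hz'.1, hmn, hz'.2⟩] at h
    rw [if_pos hz, if_pos hz']
    have hmk := (Prod.mk.inj h).2
    simp only [markAt, Prod.mk.injEq] at hmk
    obtain ⟨-, hpm⟩ := hmk
    congr 1
    refine Finset.sum_congr rfl fun i _ => ?_
    have hi := congrFun hpm i
    simp only [particleMarkAt, Prod.mk.injEq] at hi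
    obtain ⟨-, -, -, h4, h5, h6, -, h8⟩ := hi
    simp only [payloadAt, binVal, h4, h5, h6, h8]
  · rw [if_pos ⟨hz.1, hmn, hz.2⟩, if_neg (fun h' => hz' ⟨h'.1, h'.2.2⟩)] at h
    cases (Prod.mk.inj h).1
  · rw [if_neg (fun h' => hz ⟨h'.1, h'.2.2⟩), if_pos ⟨hz'.1, hmn, hz'.2⟩] at h
    cases (Prod.mk.inj h).1
  · rw [if_neg hz, if_neg hz']

/-- **`Ỹₘ` is `causalSigma … n`-measurable for `m < n`** (a function of a countably-valued
measurable coordinate of the record). [folklore] -/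
theorem measurable_payloadY_causalSigma (θ : ℝ) (u₀ : V3) (φ' : T3 → ℝ) (ψ₀ : V3 → ℝ) (c b : ℝ)
    (K : ℕ) (τ δt δx δv δφ δ₀ : ℝ) (Φ : Flow σ N) {m n : ℕ} (hmn : m < n) :
    Measurable[causalSigma θ u₀ φ' ψ₀ K τ δt δx δv δφ δ₀ Φ n]
      (payloadY θ u₀ φ' ψ₀ c b K τ δφ δ₀ Φ m) :=
  measurable_comap_of_factorsThrough (record θ u₀ φ' ψ₀ K τ δt δx δv δφ δ₀ Φ n)
    (measurable_pi_apply m) fun _ _ h =>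
      payloadY_eq_of_record_eq θ u₀ φ' ψ₀ c b K τ δt δx δv δφ δ₀ Φ hmn h

/-- **`X̃ₙ` is `causalSigma … n`-measurable** (finite sum of the `Ỹₘ`, `m < n`). [folklore] -/
theorem measurable_procX_causalSigma (θ : ℝ) (u₀ : V3) (φ' : T3 → ℝ) (ψ₀ : V3 → ℝ) (c b : ℝ)
    (K : ℕ) (τ δt δx δv δφ δ₀ : ℝ) (Φ : Flow σ N) (n : ℕ) :
    Measurable[causalSigma θ u₀ φ' ψ₀ K τ δt δx δv δφ δ₀ Φ n]
      (procX θ u₀ φ' ψ₀ c b K τ δφ δ₀ Φ n) := by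
  unfold procX
  exact Finset.measurable_sum (Finset.range n) fun m hm =>
    measurable_payloadY_causalSigma θ u₀ φ' ψ₀ c b K τ δt δx δv δφ δ₀ Φ (Finset.mem_range.1 hm)

/-- **`X̃ₙ` is Borel measurable for every `n`** (continuous `φ'`, `ψ₀`): it is `causalSigma … n`-measurable
and `causalSigma … n ≤ m0` (any meshes `δt, δx, δv`, here `1`). [folklore] -/
theorem measurable_procX (θ : ℝ) (u₀ : V3) {φ' : T3 → ℝ} {ψ₀ : V3 → ℝ} (hφ : Continuous φ')
    (hψ : Continuous ψ₀) (c b : ℝ) (K : ℕ) (τ δφ δ₀ : ℝ) (Φ : Flow σ N) (n : ℕ) :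
    Measurable (procX θ u₀ φ' ψ₀ c b K τ δφ δ₀ Φ n) :=
  (measurable_procX_causalSigma θ u₀ φ' ψ₀ c b K τ 1 1 1 δφ δ₀ Φ n).mono
    (causalSigma_le θ u₀ hφ hψ K τ 1 1 1 δφ δ₀ Φ n) le_rfl

/-! ## The registered stub -/

/-- **Registered stub S6a `stub_causalFiltration`** of the line `dynkin-azuma-collision-innovations`
(crux stmt-AtomisticToContinuum-10967): the causal coarse σ-algebras `causalSigma … n` form a
filtration of the Borel σ-algebra of phase space to which the binned collision-payload process `X̃`
is strongly adapted. [folklore] -/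
theorem stub_causalFiltration :
    ∀ (θ : ℝ) (u₀ : V3) (φ' : T3 → ℝ) (ψ₀ : V3 → ℝ) (c b : ℝ) (K : ℕ) (τ δt δx δv δφ δ₀ : ℝ),
      Continuous φ' → Continuous ψ₀ → 0 < δt → 0 < δx → 0 < δv → 0 < δφ → 0 < δ₀ →
      ∀ (σ : ℝ) (N : ℕ) (Φ : Flow σ N),
        ∃ ℱ : Filtration ℕ (inferInstance : MeasurableSpace (Phase N)),
          StronglyAdapted ℱ (procX θ u₀ φ' ψ₀ c b K τ δφ δ₀ Φ) ∧
          ∀ n, (ℱ n : MeasurableSpace (Phase N)) ≤ causalSigma θ u₀ φ' ψ₀ K τ δt δx δv δφ δ₀ Φ n := by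
  intro θ u₀ φ' ψ₀ c b K τ δt δx δv δφ δ₀ hφ hψ _ _ _ _ _ σ N Φ
  refine ⟨⟨fun n => causalSigma θ u₀ φ' ψ₀ K τ δt δx δv δφ δ₀ Φ n,
      monotone_nat_of_le_succ fun n => causalSigma_le_succ θ u₀ φ' ψ₀ K τ δt δx δv δφ δ₀ Φ n,
      fun n => causalSigma_le θ u₀ hφ hψ K τ δt δx δv δφ δ₀ Φ n⟩, fun n => ?_, fun n => le_rfl⟩
  exact (measurable_procX_causalSigma θ u₀ φ' ψ₀ c b K τ δt δx δv δφ δ₀ Φ n).stronglyMeasurable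

end Summit.AtomisticToContinuum.HydrodynamicLimit.Theorems.DynkinAzuma

end
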